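import Literature.NumberTheory.Automorphic.Liu2021.ThetaLiftFromLineIrreducible
import Literature.NumberTheory.Rogawski1990.CurveThetaCohFinComponentUnique
import HarnessLib

/-!
# LD1 organ definitions for the in-house road of the letter (I′) `stub_letter_thetaIrr : ThetaSpaceIrreducible₂` — the THETA GERM PACKAGE `ThetaGerm₂` and its
# one road «germ := span of all theta classes»: sub-organs (Gα) `ThetaDichotomy₂`, (Gβ) `ThetaSlice₂` (definitions + one composition theorem; no `sorry`)

Cell `hodgecm-mathlib` (D-0151), FLOOR 0, half A line LD1 (socket `stub_S1_facts`, books row #73; leaf `Cruxes/HLiu418/Lines/F0_P6LD_StubS1FactsThetaRoad.lean`, ED. 6 to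
come), dealer LD1-plan (g2) DEALS #2 plate «GERM-DEFS + CLOSER» (a), seat LD1-p01 (g2), 2026-09-02.  Cut TOKEN-FOR-TOKEN from LD1-plan (g2)'s HOME skeleton
`F0/P6/LD/LD1-plan/g2/ThetaIrr.inhouse.skeleton.v3.LD1-plan-g2.lean` (sha16 61913d0c669d9769, GREEN; LD-ref1 (g2) BOX #1 GREEN R1–R4) §0, §2, §2b; pattern ★
`F0LD2LineThetaTypesComplementaryDefs` (p850386).  DEFINITIONS + ONE THEOREM; nothing asserted; `--supports stmt-HodgeConjecture-24832`.  The closer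
`Theorems/F0LD1ThetaIrrOfGerm.lean` ((b) of the plate) proves the leaf's letter body (I′) BY VALUE from `ThetaGerm₂` over ★ organ (D)
`ContRepresentation.ClosedSubrep.isTopIrreducible_of_denseSubmoduleGerm` (p850432∕p850456); the leaf's ED. 6 then reads `stub_organ_thetaGerm : ThetaGerm₂ := by sorry` +
`stub_letter_thetaIrr := F0LD1ThetaIrrOfGerm.thetaLiftFromLineIrreducible_of_thetaGerm₂ stub_organ_thetaGerm`.

CONTENT.
* §0 `lineThetaClassSet` — the set of ALL `(a, ξ)`-theta classes in `L²([U(H)])` (the set-builder inlined in ★ `Liu2021.ThetaLiftFromLineIrreducible`, NAMED; rank-generic)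
  + `thetaLiftFromLineIrreducible_iff_classSet` (`Iff.rfl`).
* §2 ORGAN (G) `ThetaGerm₂ : Prop` — over the EXACT binder prefix of the leaf's `ThetaSpaceIrreducible₂`: a ℂ-subspace `S ⊆ L²` with `closure S = closure (span of the
  (a′, ξ)-theta classes)`, GERM-IRREDUCIBLE (`S ≤ Q ∨ S ⊓ Q = ⊥` for every closed `R`-invariant `Q`), and `S = ⊥` or an ADMISSIBLE NON-ZERO SLICE (`E` bounded, preserving
  closed invariant subspaces and `S`, `E(S)` finite-dimensional, `E|_S ≠ 0`).
* §2b ONE ROAD, germ := the span of all theta classes: (Gα) `ThetaDichotomy₂` (every closed invariant `Q` contains all theta classes or meets their span in `0` — the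
  algebraic-irreducibility content: local Howe duality at every place + restricted tensor product + `K_∞`-isotypic bootstrap), (Gβ) `ThetaSlice₂` (an admissible
  non-zero slice: local admissibility + unramified lines + one `K_∞`-type), and `thetaGerm₂_of_dichotomy_slice : ThetaDichotomy₂ → ThetaSlice₂ → ThetaGerm₂` (PROVED).
Organ definitions carry prose locators only (no cite tags: they are the line's organs, not printed facts).

HONEST LABEL.  Nothing printed is discharged by this file; (Gα)∕(Gβ) hold 100 % of the letter's non-elementary content; HC_CM is proved only modulo the 7 printed citations
(2 remaining: hLiu418 = stmt-HodgeConjecture-24832, h413 = stmt-HodgeConjecture-24833) until rung 0 closes; count-neutral.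

References: [Liu2021] Y. Liu, Camb. J. Math. 9 (2021), App. B Cor. B.6 (1) p. 99; [Wu2013] C. Wu, J. Number Theory 133 (2013), Thm. 5.3; [Rallis1984] S. Rallis,
Compositio Math. 51 (1984), §1; [MoeglinVignerasWaldspurger1987] LNM 1291, chap. 3 IV.4; [Howe1989] R. Howe, J. AMS 2 (1989); [BorelJacquet1979] PSPM 33.1 §4.6;
[Dixmier1977] §5.4; [Flath1979] D. Flath, PSPM 33.1, Thm. 2.
-/

set_option autoImplicit false
set_option linter.dupNamespace false

noncomputable section

open NumberField NumberField.InfinitePlace MeasureTheory IsDedekindDomain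
open scoped Matrix ComplexOrder ENNReal
open Literature.NumberTheory.Automorphic Literature.NumberTheory.Automorphic.UnitaryGroup
open Literature.NumberTheory.Automorphic.UnitaryGroup.CotangentForms (toQuotFun)
open Literature.NumberTheory.Automorphic.UnitaryCurveForms
open Literature.NumberTheory.Automorphic.Liu2021 Literature.NumberTheory.Automorphic.Liu2021.Def411WeilCarriers
open Literature.NumberTheory.Automorphic.Liu2021.Def411WeilCarriersDoubling
open Literature.NumberTheory.GaloisRepresentations Literature.NumberTheory.Automorphic.IdeleClassGroup
open Literature.NumberTheory.GelbartRogawski1991 Literature.NumberTheory.GelbartRogawski1991.UnitaryDualPair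
open Literature.NumberTheory.GelbartRogawski1991.UnitaryDualPair.WeilCoinv
open Literature.NumberTheory.Weil1964
open Literature.RepresentationTheory.Liu2021 Literature.RepresentationTheory.HarrisKudlaSweet1996
open Literature.RepresentationTheory.CompactGroups
open Literature.NumberTheory.Rogawski1990

namespace Summit.HodgeConjecture.HodgeConjecture.Cruxes.HLiu418.F0LD1ThetaGermDefs

/-! ## §0 The set of all `(a, ξ)`-theta classes, NAMED (token-for-token the set-builder inlined in ★ `Liu2021.ThetaLiftFromLineIrreducible`) -/

section ClassSet

variable (L : Type) [Field L] [NumberField L] [IsCMField L] (N : ℕ) (H : Matrix (Fin N) (Fin N) L)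
  {n' : ℕ} (e₁ : Fin N × Fin 1 ≃ Fin n') (dV : Fin N → L) (hdV : ∀ i, IsCMField.complexConj L (dV i) = dV i)
  (hdV0 : ∀ i, dV i ≠ 0)
  (ιA : (adelicGroupData (↥(maximalRealSubfield L)) L (IsCMField.complexConj L) N H).Adelic →* ↥(UnitaryGroup.adelic (↥(maximalRealSubfield L)) L (IsCMField.complexConj L) N (Matrix.diagonal dV)))
  [CompactSpace (↥(UnitaryGroup.adelic (↥(maximalRealSubfield L)) L (IsCMField.complexConj L) N (Matrix.diagonal dV)) ⧸ (UnitaryGroup.toAdelic (↥(maximalRealSubfield L)) L (IsCMField.complexConj L) N (Matrix.diagonal dV)).range)]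
  (μA : Measure (adelicGroupData (↥(maximalRealSubfield L)) L (IsCMField.complexConj L) N H).automorphicQuotient) [(adelicGroupData (↥(maximalRealSubfield L)) L (IsCMField.complexConj L) N H).IsAutomorphicMeasure μA]
  (μ : Literature.NumberTheory.Automorphic.IdeleClassGroup L →ₜ* Circle) (hμ : IsConjugateSymplectic L μ) (a : (↥(maximalRealSubfield L))ˣ)
  (ξ : haveI := normal_range_toAdelic_JW L a
    PontryaginDual (↥(UnitaryGroup.adelic (↥(maximalRealSubfield L)) L (IsCMField.complexConj L) 1 (JW (↥(maximalRealSubfield L)) L a)) ⧸ (UnitaryGroup.toAdelic (↥(maximalRealSubfield L)) L (IsCMField.complexConj L) 1 (JW (↥(maximalRealSubfield L)) L a)).range))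

/-- The set of ALL `(a, ξ)`-theta classes `[x ↦ Θ̃_Ψ(ξ)(ιA x)]` in `L²([U(H)], μA)` (all Weil-majorant witnesses `hρ`, all finite invariant measures `μW` on
`[U(⟨a⟩)]`, all Schwartz–Bruhat `Ψ`) — the generating set of ★ `Liu2021.ThetaLiftFromLineIrreducible` ∕ ★ `exists_closedSubrep_thetaSpan`, given a name.
[cite: Liu2021, App. B Cor. B.6 (1) (p. 99)] [cite: Rallis1984, §1] -/
def lineThetaClassSet : Set ((adelicGroupData (↥(maximalRealSubfield L)) L (IsCMField.complexConj L) N H).L2 μA) :=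
  letI : MeasurableSpace (↥(UnitaryGroup.adelic (↥(maximalRealSubfield L)) L (IsCMField.complexConj L) 1 (JW (↥(maximalRealSubfield L)) L a)) ⧸ (UnitaryGroup.toAdelic (↥(maximalRealSubfield L)) L (IsCMField.complexConj L) 1 (JW (↥(maximalRealSubfield L)) L a)).range) := borel _
  haveI := normal_range_toAdelic_JW L a;
        {v : (adelicGroupData (↥(maximalRealSubfield L)) L (IsCMField.complexConj L) N H).L2 μA | ∃ (hρ : HasThetaMajorants fun
      (p : ↥(UnitaryGroup.adelic (↥(maximalRealSubfield L)) L (IsCMField.complexConj L) N (Matrix.diagonal dV)) × ↥(UnitaryGroup.adelic (↥(maximalRealSubfield L)) L (IsCMField.complexConj L) 1 (JW (↥(maximalRealSubfield L)) L a))) (Φ : piSchwartzBruhat (↥(maximalRealSubfield L)) (Fin n')) =>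
        pairRep (↥(maximalRealSubfield L)) L (IsCMField.complexConj L) N 1 e₁ (Matrix.diagonal dV) (JW (↥(maximalRealSubfield L)) L a)
          (chiSplittingLine L e₁ dV hdV hdV0 (toHeckeCharacter L μ) (isUnitary_toHeckeCharacter L μ)
            ((isOscillatorChar_toHeckeCharacter_iff μ).mpr hμ) (TW (↥(maximalRealSubfield L)) a)
            (isUnit_det_TW (↥(maximalRealSubfield L)) a) (JW (↥(maximalRealSubfield L)) L a) (JW_eq (↥(maximalRealSubfield L)) L a))
          p Φ)
        (μW : Measure (↥(UnitaryGroup.adelic (↥(maximalRealSubfield L)) L (IsCMField.complexConj L) 1 (JW (↥(maximalRealSubfield L)) L a)) ⧸ (UnitaryGroup.toAdelic (↥(maximalRealSubfield L)) L (IsCMField.complexConj L) 1 (JW (↥(maximalRealSubfield L)) L a)).range)) (_ : IsFiniteMeasure μW)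
        (_ : SMulInvariantMeasure ↥(UnitaryGroup.adelic (↥(maximalRealSubfield L)) L (IsCMField.complexConj L) 1 (JW (↥(maximalRealSubfield L)) L a)) (↥(UnitaryGroup.adelic (↥(maximalRealSubfield L)) L (IsCMField.complexConj L) 1 (JW (↥(maximalRealSubfield L)) L a)) ⧸ (UnitaryGroup.toAdelic (↥(maximalRealSubfield L)) L (IsCMField.complexConj L) 1 (JW (↥(maximalRealSubfield L)) L a)).range) μW)
        (Ψ : piSchwartzBruhat (↥(maximalRealSubfield L)) (Fin n'))
        (hθ : MemLp (toQuotFun (adelicGroupData (↥(maximalRealSubfield L)) L (IsCMField.complexConj L) N H) fun x =>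
          (lineThetaKernelDatum L N e₁ dV hdV hdV0 μ hμ a hρ).thetaLiftFun μW Ψ (charCM ξ) (ιA x)) 2 μA),
        v = MemLp.toLp _ hθ}

/-- ★ `ThetaLiftFromLineIrreducible` read through the named class set (definitional unfolding). [cite: Liu2021, App. B Cor. B.6 (1) (p. 99)] -/
theorem thetaLiftFromLineIrreducible_iff_classSet :
    ThetaLiftFromLineIrreducible L N H e₁ dV hdV hdV0 ιA μA μ hμ a ξ ↔
      (letI : MeasurableSpace (↥(UnitaryGroup.adelic (↥(maximalRealSubfield L)) L (IsCMField.complexConj L) 1 (JW (↥(maximalRealSubfield L)) L a)) ⧸ (UnitaryGroup.toAdelic (↥(maximalRealSubfield L)) L (IsCMField.complexConj L) 1 (JW (↥(maximalRealSubfield L)) L a)).range) := borel _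
      haveI := normal_range_toAdelic_JW L a
      ∀ Q : ContRepresentation.ClosedSubrep ((adelicGroupData (↥(maximalRealSubfield L)) L (IsCMField.complexConj L) N H).rightRegular μA),
        (Q.toSubmodule : Set ((adelicGroupData (↥(maximalRealSubfield L)) L (IsCMField.complexConj L) N H).L2 μA)) =
          closure (Submodule.span ℂ (lineThetaClassSet L N H e₁ dV hdV hdV0 ιA μA μ hμ a ξ) : Set ((adelicGroupData (↥(maximalRealSubfield L)) L (IsCMField.complexConj L) N H).L2 μA)) →
        Q.toSubmodule = ⊥ ∨ Q.toContRep.IsTopIrreducible) :=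
  Iff.rfl

end ClassSet

/-! ## §2 Organ (G): the THETA GERM PACKAGE over the CM curve frames -/

/-- **ORGAN (G) `ThetaGerm₂`** — over the EXACT binder prefix of the leaf's `ThetaSpaceIrreducible₂` (CM `L`, `[L:ℚ] ≥ 4`; `H` of signature `(1,1)` at `ι`, definite
elsewhere; scaled frame; conjugate-symplectic `λ` of weight one; pinned transport `ιA`; `[U(diag dV)]` compact), for every line `a′` and character `ξ` of `[U(⟨a′⟩)]`:
there is a ℂ-subspace `S` of `L²([U(H)], μ)` with (i) `closure S = closure (span of all (a′, ξ)-theta classes)`; (ii) GERM IRREDUCIBILITY: every closed `R`-invariant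
`Q` contains `S` or meets it in `0`; (iii) `S = 0`, or an ADMISSIBLE NON-ZERO SLICE: a bounded `E` on `L²` mapping every closed `R`-invariant subspace into itself, with
`E S ⊆ S`, `E S` finite-dimensional, `E|_S ≠ 0`.  Intended witness: `S` = the `K_∞`-finite `ξ`-theta germ, `E = R(e_K ⊗ e_κ)`; content (G1) Hecke equivariance of the
theta map, (G2) density of `K_∞`-finite thetas, (G3) algebraic irreducibility of the germ ⇐ LOCAL Howe duality at all places + restricted tensor product, (G4) finite
non-zero slice ⇐ local admissibility + unramified lines + one archimedean `K_∞`-type (module docstring).  ORGAN-GRADE.  Why it might fail: (G3) at the archimedean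
place `ι` needs the irreducibility of the Harish-Chandra module of `Θ_ι(ξ_ι)` for `U(1) × U(1,1)` (holomorphic discrete series or a limit — [KashiwaraVergne1978]);
a wrong choice of germ (smooth instead of `K_∞`-finite) makes (ii) false. -/
def ThetaGerm₂ : Prop :=
  ∀ (L : Type) [Field L] [NumberField L] [IsCMField L] (ι : L →+* ℂ) (H : Matrix (Fin 2) (Fin 2) L)
      (dV : Fin 2 → L) (hdV : ∀ i, IsCMField.complexConj L (dV i) = dV i) (hdV0 : ∀ i, dV i ≠ 0)
      (t : L) (ht : t ≠ 0) (g : GL (Fin 2) L)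
      (_hg : formCongr ((IsCMField.complexConj L : L ≃ₐ[↥(maximalRealSubfield L)] L) : L →+* L) g (t • H) = Matrix.diagonal dV),
      (∃ T : GL (Fin 2) ℂ, formCongr (starRingEnd ℂ) T ((Matrix.diagonal dV).map ι) = Matrix.diagonal ![(1 : ℂ), -1]) →
      (∀ τ' : L →+* ℂ, InfinitePlace.mk τ' ≠ InfinitePlace.mk ι → ((Matrix.diagonal dV).map τ').PosDef) →
      4 ≤ Module.finrank ℚ L →
      ∀ (μ : Measure (adelicGroupData (↥(maximalRealSubfield L)) L (IsCMField.complexConj L) 2 H).automorphicQuotient)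
        [(adelicGroupData (↥(maximalRealSubfield L)) L (IsCMField.complexConj L) 2 H).IsAutomorphicMeasure μ]
        {n' : ℕ} (e₁ : Fin 2 × Fin 1 ≃ Fin n')
        (lam : Literature.NumberTheory.Automorphic.IdeleClassGroup L →ₜ* Circle) (hlam : IsConjugateSymplectic L lam), HasWeight L lam 1 →
      ∀ (ιA : (adelicGroupData (↥(maximalRealSubfield L)) L (IsCMField.complexConj L) 2 H).Adelic →*
          ↥(UnitaryGroup.adelic (↥(maximalRealSubfield L)) L (IsCMField.complexConj L) 2 (Matrix.diagonal dV))),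
        (∀ k, ((ιA k : ↥(UnitaryGroup.adelic (↥(maximalRealSubfield L)) L (IsCMField.complexConj L) 2 (Matrix.diagonal dV))) :
              GL (Fin 2) (AdeleRing (𝓞 L) L)) =
            (toAdeleGL L g)⁻¹ * adelicVal (↥(maximalRealSubfield L)) L (IsCMField.complexConj L) 2 H k * toAdeleGL L g) →
      ∀ [CompactSpace (↥(UnitaryGroup.adelic (↥(maximalRealSubfield L)) L (IsCMField.complexConj L) 2 (Matrix.diagonal dV)) ⧸
          (UnitaryGroup.toAdelic (↥(maximalRealSubfield L)) L (IsCMField.complexConj L) 2 (Matrix.diagonal dV)).range)],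
      ∀ (a' : (↥(maximalRealSubfield L))ˣ)
        (ξ : haveI := normal_range_toAdelic_JW L a'
          PontryaginDual (↥(UnitaryGroup.adelic (↥(maximalRealSubfield L)) L (IsCMField.complexConj L) 1 (JW (↥(maximalRealSubfield L)) L a')) ⧸ (UnitaryGroup.toAdelic (↥(maximalRealSubfield L)) L (IsCMField.complexConj L) 1 (JW (↥(maximalRealSubfield L)) L a')).range)),
        letI : MeasurableSpace (↥(UnitaryGroup.adelic (↥(maximalRealSubfield L)) L (IsCMField.complexConj L) 1 (JW (↥(maximalRealSubfield L)) L a')) ⧸ (UnitaryGroup.toAdelic (↥(maximalRealSubfield L)) L (IsCMField.complexConj L) 1 (JW (↥(maximalRealSubfield L)) L a')).range) := borel _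
        haveI := normal_range_toAdelic_JW L a'
        ∃ S : Submodule ℂ ((adelicGroupData (↥(maximalRealSubfield L)) L (IsCMField.complexConj L) 2 H).L2 μ),
          closure (S : Set ((adelicGroupData (↥(maximalRealSubfield L)) L (IsCMField.complexConj L) 2 H).L2 μ)) = closure (Submodule.span ℂ (lineThetaClassSet L 2 H e₁ dV hdV hdV0 ιA μ lam hlam a' ξ) : Set ((adelicGroupData (↥(maximalRealSubfield L)) L (IsCMField.complexConj L) 2 H).L2 μ)) ∧
          (∀ Q : ContRepresentation.ClosedSubrep ((adelicGroupData (↥(maximalRealSubfield L)) L (IsCMField.complexConj L) 2 H).rightRegular μ), S ≤ Q.toSubmodule ∨ S ⊓ Q.toSubmodule = ⊥) ∧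
          (S = ⊥ ∨ ∃ E : ((adelicGroupData (↥(maximalRealSubfield L)) L (IsCMField.complexConj L) 2 H).L2 μ) →L[ℂ] ((adelicGroupData (↥(maximalRealSubfield L)) L (IsCMField.complexConj L) 2 H).L2 μ),
            (∀ Q : ContRepresentation.ClosedSubrep ((adelicGroupData (↥(maximalRealSubfield L)) L (IsCMField.complexConj L) 2 H).rightRegular μ), ∀ v ∈ Q, E v ∈ Q) ∧ (∀ v ∈ S, E v ∈ S) ∧
            FiniteDimensional ℂ ↥(S.map E.toLinearMap) ∧ ∃ w ∈ S, E w ≠ 0)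

/-! ## §2b One ROAD to organ (G): the germ `S :=` the span of ALL theta classes — sub-organs (Gα) DICHOTOMY and (Gβ) SLICE -/

/-- **SUB-ORGAN (Gα) `ThetaDichotomy₂` — THE THETA DICHOTOMY FOR CLOSED INVARIANT SUBSPACES** (the algebraic-irreducibility content of (I′), in
EXISTING currency, no new object): over the frames, for every line `a′`, character `ξ` and every CLOSED `R`-INVARIANT subspace `Q ⊆ L²([U(H)])`: EITHER
every `(a′, ξ)`-theta class lies in `Q`, OR no non-zero element of their span does.  (For an irreducible = discrete `Q` this is the leaf's (I-A)
`CharSeam₂ ⟹ CharThetaSpaceLe₂`; (I′) ⟹ (Gα) by intersecting with the closed theta span; conversely (Gα) + (Gβ) ⟹ (I′) through (D).)  Content: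
the preimage `{Ψ : θ_Ψ(ξ) ∈ Q}` is a `U(H)(𝔸)`-submodule of the global Weil module; irreducibility of the `K_∞`-finite global theta module
`⊗′_v Θ_v(ξ_v)` ⇐ LOCAL Howe duality at every place (finite non-split ★ `mvw_IV4_rankOne_irreducibleOrZero_holds`; finite split: type II
`(GL₁, GL₂)`; archimedean: Fock-model Harish-Chandra modules [Howe1989]) + the restricted tensor product [Flath1979, Thm. 2] + `K_∞`-isotypic
bootstrapping from the `K_∞`-finite germ to the full span (Peter–Weyl on `K_∞`, ★ `CompactGroupCharacterProjectionIsotypic`).  ORGAN-GRADE (L–XL).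
Why it might fail: only if mis-typed — as a statement it FOLLOWS from the printed (I′) [Liu2021, Cor. B.6 (1)]. -/
def ThetaDichotomy₂ : Prop :=
  ∀ (L : Type) [Field L] [NumberField L] [IsCMField L] (ι : L →+* ℂ) (H : Matrix (Fin 2) (Fin 2) L)
      (dV : Fin 2 → L) (hdV : ∀ i, IsCMField.complexConj L (dV i) = dV i) (hdV0 : ∀ i, dV i ≠ 0)
      (t : L) (ht : t ≠ 0) (g : GL (Fin 2) L)
      (_hg : formCongr ((IsCMField.complexConj L : L ≃ₐ[↥(maximalRealSubfield L)] L) : L →+* L) g (t • H) = Matrix.diagonal dV),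
      (∃ T : GL (Fin 2) ℂ, formCongr (starRingEnd ℂ) T ((Matrix.diagonal dV).map ι) = Matrix.diagonal ![(1 : ℂ), -1]) →
      (∀ τ' : L →+* ℂ, InfinitePlace.mk τ' ≠ InfinitePlace.mk ι → ((Matrix.diagonal dV).map τ').PosDef) →
      4 ≤ Module.finrank ℚ L →
      ∀ (μ : Measure (adelicGroupData (↥(maximalRealSubfield L)) L (IsCMField.complexConj L) 2 H).automorphicQuotient)
        [(adelicGroupData (↥(maximalRealSubfield L)) L (IsCMField.complexConj L) 2 H).IsAutomorphicMeasure μ]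
        {n' : ℕ} (e₁ : Fin 2 × Fin 1 ≃ Fin n')
        (lam : Literature.NumberTheory.Automorphic.IdeleClassGroup L →ₜ* Circle) (hlam : IsConjugateSymplectic L lam), HasWeight L lam 1 →
      ∀ (ιA : (adelicGroupData (↥(maximalRealSubfield L)) L (IsCMField.complexConj L) 2 H).Adelic →*
          ↥(UnitaryGroup.adelic (↥(maximalRealSubfield L)) L (IsCMField.complexConj L) 2 (Matrix.diagonal dV))),
        (∀ k, ((ιA k : ↥(UnitaryGroup.adelic (↥(maximalRealSubfield L)) L (IsCMField.complexConj L) 2 (Matrix.diagonal dV))) :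
              GL (Fin 2) (AdeleRing (𝓞 L) L)) =
            (toAdeleGL L g)⁻¹ * adelicVal (↥(maximalRealSubfield L)) L (IsCMField.complexConj L) 2 H k * toAdeleGL L g) →
      ∀ [CompactSpace (↥(UnitaryGroup.adelic (↥(maximalRealSubfield L)) L (IsCMField.complexConj L) 2 (Matrix.diagonal dV)) ⧸
          (UnitaryGroup.toAdelic (↥(maximalRealSubfield L)) L (IsCMField.complexConj L) 2 (Matrix.diagonal dV)).range)],
      ∀ (a' : (↥(maximalRealSubfield L))ˣ)
        (ξ : haveI := normal_range_toAdelic_JW L a'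
          PontryaginDual (↥(UnitaryGroup.adelic (↥(maximalRealSubfield L)) L (IsCMField.complexConj L) 1 (JW (↥(maximalRealSubfield L)) L a')) ⧸ (UnitaryGroup.toAdelic (↥(maximalRealSubfield L)) L (IsCMField.complexConj L) 1 (JW (↥(maximalRealSubfield L)) L a')).range)),
        letI : MeasurableSpace (↥(UnitaryGroup.adelic (↥(maximalRealSubfield L)) L (IsCMField.complexConj L) 1 (JW (↥(maximalRealSubfield L)) L a')) ⧸ (UnitaryGroup.toAdelic (↥(maximalRealSubfield L)) L (IsCMField.complexConj L) 1 (JW (↥(maximalRealSubfield L)) L a')).range) := borel _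
        haveI := normal_range_toAdelic_JW L a'
        ∀ Q : ContRepresentation.ClosedSubrep ((adelicGroupData (↥(maximalRealSubfield L)) L (IsCMField.complexConj L) 2 H).rightRegular μ),
          (Submodule.span ℂ (lineThetaClassSet L 2 H e₁ dV hdV hdV0 ιA μ lam hlam a' ξ)) ≤ Q.toSubmodule ∨
            (Submodule.span ℂ (lineThetaClassSet L 2 H e₁ dV hdV hdV0 ιA μ lam hlam a' ξ)) ⊓ Q.toSubmodule = ⊥

/-- **SUB-ORGAN (Gβ) `ThetaSlice₂` — AN ADMISSIBLE NON-ZERO SLICE OF THE THETA SPAN** (analytic, in-house road over the tree's compact-group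
stock): over the frames, for every `a′, ξ`: the span of the `(a′, ξ)`-theta classes is `0`, OR there is a bounded operator `E` on `L²([U(H)])` mapping
every closed `R`-invariant subspace into itself and the theta span into itself, with `E(span)` FINITE-DIMENSIONAL and `E ≠ 0` on the span.
Intended witness: `E = e_κ ∘ e_K` = the character projector of an irreducible representation `κ` of a compact subgroup `K = K_f × K_∞ ⊆ U(H)(𝔸_{L⁺})`
for `R|_K` (★ `Schur.charProjL`, ★ `CompactGroupCharacterProjectionIsotypic`, ★ `ContRepresentation.vectorAverage`), `K_f` compact open,
`κ|_{K_f}` trivial, `κ|_{K_∞}` a `K_∞`-type of a chosen non-zero theta class: (1) `E Q ⊆ Q` (integral of `R(k) v ∈ Q`); (2) `E θ_Ψ = θ_{e_κ Ψ}`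
(★ kit `rightRegular_toLp_lineThetaLift` + Fubini under the majorants) and `e_κ Ψ` is again Schwartz–Bruhat; (3) `E(span) =` theta classes of
`(K_f`-fixed, `κ`-isotypic) data — finite-dimensional by LOCAL ADMISSIBILITY (non-split ★ `mvw_IV4_rankOne_admissible`; split; archimedean
weight spaces of the Fock model) and the unramified LINE `dim Θ_v(ξ_v)^{K_v} = 1` at almost all `v`; (4) `E θ₀ ≠ 0` by the choice of `κ`
(Peter–Weyl).  ORGAN-GRADE (L).  Why it might fail: finite-dimensionality in (3) needs the unramified line at ALL but finitely many places —
a level `K_f` that is not hyperspecial almost everywhere breaks it (choose `K_f = ∏ U(H)(𝒪_v)` outside a finite set). -/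
def ThetaSlice₂ : Prop :=
  ∀ (L : Type) [Field L] [NumberField L] [IsCMField L] (ι : L →+* ℂ) (H : Matrix (Fin 2) (Fin 2) L)
      (dV : Fin 2 → L) (hdV : ∀ i, IsCMField.complexConj L (dV i) = dV i) (hdV0 : ∀ i, dV i ≠ 0)
      (t : L) (ht : t ≠ 0) (g : GL (Fin 2) L)
      (_hg : formCongr ((IsCMField.complexConj L : L ≃ₐ[↥(maximalRealSubfield L)] L) : L →+* L) g (t • H) = Matrix.diagonal dV),
      (∃ T : GL (Fin 2) ℂ, formCongr (starRingEnd ℂ) T ((Matrix.diagonal dV).map ι) = Matrix.diagonal ![(1 : ℂ), -1]) →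
      (∀ τ' : L →+* ℂ, InfinitePlace.mk τ' ≠ InfinitePlace.mk ι → ((Matrix.diagonal dV).map τ').PosDef) →
      4 ≤ Module.finrank ℚ L →
      ∀ (μ : Measure (adelicGroupData (↥(maximalRealSubfield L)) L (IsCMField.complexConj L) 2 H).automorphicQuotient)
        [(adelicGroupData (↥(maximalRealSubfield L)) L (IsCMField.complexConj L) 2 H).IsAutomorphicMeasure μ]
        {n' : ℕ} (e₁ : Fin 2 × Fin 1 ≃ Fin n')
        (lam : Literature.NumberTheory.Automorphic.IdeleClassGroup L →ₜ* Circle) (hlam : IsConjugateSymplectic L lam), HasWeight L lam 1 →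
      ∀ (ιA : (adelicGroupData (↥(maximalRealSubfield L)) L (IsCMField.complexConj L) 2 H).Adelic →*
          ↥(UnitaryGroup.adelic (↥(maximalRealSubfield L)) L (IsCMField.complexConj L) 2 (Matrix.diagonal dV))),
        (∀ k, ((ιA k : ↥(UnitaryGroup.adelic (↥(maximalRealSubfield L)) L (IsCMField.complexConj L) 2 (Matrix.diagonal dV))) :
              GL (Fin 2) (AdeleRing (𝓞 L) L)) =
            (toAdeleGL L g)⁻¹ * adelicVal (↥(maximalRealSubfield L)) L (IsCMField.complexConj L) 2 H k * toAdeleGL L g) →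
      ∀ [CompactSpace (↥(UnitaryGroup.adelic (↥(maximalRealSubfield L)) L (IsCMField.complexConj L) 2 (Matrix.diagonal dV)) ⧸
          (UnitaryGroup.toAdelic (↥(maximalRealSubfield L)) L (IsCMField.complexConj L) 2 (Matrix.diagonal dV)).range)],
      ∀ (a' : (↥(maximalRealSubfield L))ˣ)
        (ξ : haveI := normal_range_toAdelic_JW L a'
          PontryaginDual (↥(UnitaryGroup.adelic (↥(maximalRealSubfield L)) L (IsCMField.complexConj L) 1 (JW (↥(maximalRealSubfield L)) L a')) ⧸ (UnitaryGroup.toAdelic (↥(maximalRealSubfield L)) L (IsCMField.complexConj L) 1 (JW (↥(maximalRealSubfield L)) L a')).range)),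
        letI : MeasurableSpace (↥(UnitaryGroup.adelic (↥(maximalRealSubfield L)) L (IsCMField.complexConj L) 1 (JW (↥(maximalRealSubfield L)) L a')) ⧸ (UnitaryGroup.toAdelic (↥(maximalRealSubfield L)) L (IsCMField.complexConj L) 1 (JW (↥(maximalRealSubfield L)) L a')).range) := borel _
        haveI := normal_range_toAdelic_JW L a'
        (Submodule.span ℂ (lineThetaClassSet L 2 H e₁ dV hdV hdV0 ιA μ lam hlam a' ξ)) = ⊥ ∨
          ∃ E : ((adelicGroupData (↥(maximalRealSubfield L)) L (IsCMField.complexConj L) 2 H).L2 μ) →L[ℂ] ((adelicGroupData (↥(maximalRealSubfield L)) L (IsCMField.complexConj L) 2 H).L2 μ),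
            (∀ Q : ContRepresentation.ClosedSubrep ((adelicGroupData (↥(maximalRealSubfield L)) L (IsCMField.complexConj L) 2 H).rightRegular μ), ∀ v ∈ Q, E v ∈ Q) ∧
            (∀ v ∈ (Submodule.span ℂ (lineThetaClassSet L 2 H e₁ dV hdV hdV0 ιA μ lam hlam a' ξ)), E v ∈ (Submodule.span ℂ (lineThetaClassSet L 2 H e₁ dV hdV hdV0 ιA μ lam hlam a' ξ))) ∧
            FiniteDimensional ℂ ↥((Submodule.span ℂ (lineThetaClassSet L 2 H e₁ dV hdV hdV0 ιA μ lam hlam a' ξ)).map E.toLinearMap) ∧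
            ∃ w ∈ (Submodule.span ℂ (lineThetaClassSet L 2 H e₁ dV hdV hdV0 ιA μ lam hlam a' ξ)), E w ≠ 0

/-- **ORGAN (G) FROM (Gα) + (Gβ)** with the germ `S :=` the span of all theta classes (closure clause `rfl`). [cite: Rallis1984, §1] -/
theorem thetaGerm₂_of_dichotomy_slice (hα : ThetaDichotomy₂) (hβ : ThetaSlice₂) : ThetaGerm₂ := by
  intro L _ _ _ ι H dV hdV hdV0 t ht g hg hι hdef hdeg μ _ n' e₁ lam hlam hw ιA hιA _ a' ξ
  exact ⟨_, rfl, hα L ι H dV hdV hdV0 t ht g hg hι hdef hdeg μ e₁ lam hlam hw ιA hιA a' ξ,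
    hβ L ι H dV hdV hdV0 t ht g hg hι hdef hdeg μ e₁ lam hlam hw ιA hιA a' ξ⟩

end Summit.HodgeConjecture.HodgeConjecture.Cruxes.HLiu418.F0LD1ThetaGermDefs

end
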